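import Literature.ModelTheory.ExponentialFields.KhovanskiiCurve
import HarnessLib

/-!
# The Lagrange system of a system of `L_exp`-terms

Topic `Literature/ModelTheory/ExponentialFields`. For terms `g₁(ȳ, z̄), …, g_q(ȳ, z̄)` in
`k` unknowns, the **Lagrange system** is the square system of `k + q` terms in the unknowns
`(z̄, λ̄) ∈ ℝᵏ × ℝ^q` and parameters `(ȳ, θ) ∈ ℝᵐ × ℝ^{k+q}`, `θ = (c̄, ē)`:

`zⱼ - Σᵢ λᵢ ∂gᵢ/∂zⱼ (ȳ, z̄) - cⱼ = 0 (j < k)`, `gᵢ(ȳ, z̄) - eᵢ = 0 (i < q)`,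

whose zeros at parameters `(β, c, e)` are the critical points, with their multipliers, of the
squared distance `½ Σ (zⱼ - cⱼ)²` on the level set `{g(β, ·) = e}` (the device by which the number
of connected components of a regular zero set is bounded by a number of non-degenerate zeros:
A. G. Khovanskii, *Fewnomials* (1991), Ch. III §3.8–3.14; J. Milnor, *Morse Theory*, §6; used for
A. J. Wilkie, Illinois J. Math. 33 (1989), §5, Proposition). Everything is **proved**:

* `Khovanskii.lagCore g`, `Khovanskii.lagSys g` — the terms (`lagSys = lagCore - θ`);
* `Khovanskii.lagMap g β` — the real map `Ψ_β : ℝ^{k+q} → ℝ^{k+q}` realized by `lagCore`;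
  `sysFun_lagSys`: the system realizes to `Ψ_β(w) - θ`;
* `Khovanskii.mem_ndZeros_lagSys_iff` — **`w` is a non-degenerate zero at `(β, θ)` iff
  `Ψ_β(w) = θ` and `det dΨ_β(w) ≠ 0`**, the form to which Sard's theorem applies;
* `Khovanskii.lagMap_append_eq` — the value of `Ψ_β` at `(z, λ)` in terms of `g`, `∇g`.

## References

* A. G. Khovanskii, *Fewnomials*, Transl. Math. Monogr. 88, AMS (1991), Ch. III. [Khovanskii1991]
* A. J. Wilkie, *On the theory of the real exponential field*, Illinois J. Math. 33 (1989), §5,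
  Proposition (p. 402). [Wilkie1989]
-/

noncomputable section

open FirstOrder FirstOrder.Language FirstOrder.Language.Structure

namespace Literature.ModelTheory.ExponentialFields

namespace Khovanskii

open ExpTerm RealExpModel

variable {m k q : ℕ}

/-! ### The terms -/

/-- The embedding of the unknowns `z₁, …, z_k` among `(z̄, λ̄)` (parameters unchanged). [folklore] -/
def rz (m k q : ℕ) : Fin m ⊕ Fin k → Fin m ⊕ Fin (k + q) := Sum.map _root_.id (Fin.castAdd q)

/-- **The core of the Lagrange system** (parameters `ȳ` only): for `j < k` the term
`zⱼ - Σᵢ λᵢ ∂gᵢ/∂zⱼ`, for `i < q` the term `gᵢ`. [cite: Khovanskii1991, Ch. III] -/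
def lagCore (g : Fin q → Language.orderedExpRing.Term (Fin m ⊕ Fin k)) :
    Fin (k + q) → Language.orderedExpRing.Term (Fin m ⊕ Fin (k + q)) :=
  Fin.addCases
    (fun j => var (Sum.inr (Fin.castAdd q j)) +
      -(ExpTerm.sum fun i : Fin q => var (Sum.inr (Fin.natAdd k i)) * (termPDeriv j (g i)).relabel (rz m k q)))
    (fun i => (g i).relabel (rz m k q))

/-- The embedding of the parameters `ȳ` among `(ȳ, θ)` (unknowns unchanged). [folklore] -/
def rp (m k q : ℕ) : Fin m ⊕ Fin (k + q) → Fin (m + (k + q)) ⊕ Fin (k + q) :=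
  Sum.map (Fin.castAdd (k + q)) _root_.id

/-- **The Lagrange system** `lagCore - θ`: `k + q` terms in `k + q` unknowns `(z̄, λ̄)` and
`m + (k + q)` parameters `(ȳ, θ)`. [cite: Khovanskii1991, Ch. III] -/
def lagSys (g : Fin q → Language.orderedExpRing.Term (Fin m ⊕ Fin k)) :
    Fin (k + q) → Language.orderedExpRing.Term (Fin (m + (k + q)) ⊕ Fin (k + q)) :=
  fun idx => (lagCore g idx).relabel (rp m k q) + -var (Sum.inl (Fin.natAdd m idx))

/-! ### Realizations -/

variable (g : Fin q → Language.orderedExpRing.Term (Fin m ⊕ Fin k)) (β : Fin m → ℝ)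

/-- The valuation `(β, (z, λ))` read through `rz` is `(β, z)`. [folklore] -/
theorem sumElim_append_comp_rz (z : Fin k → ℝ) (lam : Fin q → ℝ) :
    Sum.elim β (Fin.append z lam) ∘ rz m k q = Sum.elim β z := by
  funext x
  rcases x with c | j <;> simp [rz]

/-- The valuation `((β, θ), w)` read through `rp` is `(β, w)`. [folklore] -/
theorem sumElim_append_comp_rp (θ : Fin (k + q) → ℝ) (w : Fin (k + q) → ℝ) :
    Sum.elim (Fin.append β θ) w ∘ rp m k q = Sum.elim β w := by
  funext x
  rcases x with c | j <;> simp [rp]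

/-- **The real map `Ψ_β`** realized by `lagCore` at parameters `β`. [cite: Khovanskii1991, Ch. III] -/
def lagMap (w : Fin (k + q) → ℝ) : Fin (k + q) → ℝ := sysFun (lagCore g) β w

/-- `Ψ_β` at `(z, λ)`: `zⱼ - Σᵢ λᵢ ∂ⱼgᵢ(β, z)` for `j < k` and `gᵢ(β, z)` for `i < q`. [folklore] -/
theorem lagMap_append_eq (z : Fin k → ℝ) (lam : Fin q → ℝ) :
    lagMap g β (Fin.append z lam) =
      Fin.append (fun j => z j - ∑ i, lam i * grad (g i) β z j)
        (fun i => (g i).realize (Sum.elim β z)) := by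
  funext idx
  rw [lagMap, sysFun]
  refine Fin.addCases (fun j => ?_) (fun i => ?_) idx
  · rw [Fin.append_left, lagCore, Fin.addCases_left]
    simp only [ExpTerm.realize_add, ExpTerm.realize_neg, ExpTerm.realize_sum, ExpTerm.realize_mul,
      Term.realize_var, Sum.elim_inr, Fin.append_left, Fin.append_right, Term.realize_relabel,
      sumElim_append_comp_rz, grad_apply]
    ring
  · rw [Fin.append_right, lagCore, Fin.addCases_right, Term.realize_relabel, sumElim_append_comp_rz]

/-- The Lagrange system realizes to `Ψ_β(w) - θ`. [folklore] -/
theorem sysFun_lagSys (θ : Fin (k + q) → ℝ) (w : Fin (k + q) → ℝ) :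
    sysFun (lagSys g) (Fin.append β θ) w = lagMap g β w - θ := by
  funext idx
  rw [sysFun, lagSys, ExpTerm.realize_add, ExpTerm.realize_neg, Term.realize_relabel,
    sumElim_append_comp_rp, Pi.sub_apply, lagMap, sysFun]
  simp [sub_eq_add_neg]

/-- The gradient rows of the Lagrange system are those of `lagCore` at parameters `β`. [folklore] -/
theorem grad_lagSys (θ : Fin (k + q) → ℝ) (w : Fin (k + q) → ℝ) (idx : Fin (k + q)) :
    grad (lagSys g idx) (Fin.append β θ) w = grad (lagCore g idx) β w := by
  funext j
  rw [grad_apply, grad_apply, lagSys, termPDeriv_add, termPDeriv_neg, ExpTerm.realize_add,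
    ExpTerm.realize_neg, rp, realize_termPDeriv_relabel_params']
  have h := sumElim_append_comp_rp β θ w
  rw [rp] at h
  rw [h]
  simp [termPDeriv]

/-- `Ψ_β` is smooth. [folklore] -/
theorem contDiff_lagMap {n : WithTop ℕ∞} : ContDiff ℝ n (lagMap g β) :=
  contDiff_sysFun (lagCore g) β

/-- The Jacobian matrix of `lagCore` is the matrix of `dΨ_β`. [folklore] -/
theorem det_grad_lagCore_eq (w : Fin (k + q) → ℝ) :
    (Matrix.of fun idx => grad (lagCore g idx) β w).det = (fderiv ℝ (lagMap g β) w).det := by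
  have hlin : (fderiv ℝ (lagMap g β) w : (Fin (k + q) → ℝ) →ₗ[ℝ] (Fin (k + q) → ℝ)) =
      Matrix.toLin' (Matrix.of fun idx => grad (lagCore g idx) β w) := by
    apply LinearMap.ext
    intro v
    rw [Matrix.toLin'_apply, ContinuousLinearMap.coe_coe]
    exact fderiv_sysFun_apply (lagCore g) β w v
  rw [ContinuousLinearMap.det, hlin, LinearMap.det_toLin']

/-- **Non-degenerate zeros of the Lagrange system**: `w ∈ ndZeros (lagSys g) (β, θ)` iff
`Ψ_β(w) = θ` and `det dΨ_β(w) ≠ 0`. [cite: Khovanskii1991, Ch. III] -/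
theorem mem_ndZeros_lagSys_iff (θ : Fin (k + q) → ℝ) (w : Fin (k + q) → ℝ) :
    w ∈ ndZeros (lagSys g) (Fin.append β θ) ↔ lagMap g β w = θ ∧ (fderiv ℝ (lagMap g β) w).det ≠ 0 := by
  rw [mem_ndZeros]
  have h1 : (∀ i, (lagSys g i).realize (Sum.elim (Fin.append β θ) w) = 0) ↔ lagMap g β w = θ := by
    have e : (fun i => (lagSys g i).realize (Sum.elim (Fin.append β θ) w)) = lagMap g β w - θ :=
      sysFun_lagSys g β θ w
    constructor
    · intro h
      have : lagMap g β w - θ = 0 := by rw [← e]; funext i; exact h i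
      exact sub_eq_zero.1 this
    · intro h i
      have := congrFun e i
      rw [this, h, Pi.sub_apply, sub_self]
  have h2 : (Matrix.of fun i => grad (lagSys g i) (Fin.append β θ) w) =
      Matrix.of fun idx => grad (lagCore g idx) β w := by
    ext i j
    simp only [Matrix.of_apply, grad_lagSys]
  rw [h1, h2, det_grad_lagCore_eq]

/-- A critical point with multipliers gives a zero of `Ψ_β - θ`: if `z - c = Σ λᵢ ∇gᵢ(β, z)` and
`g(β, z) = e` then `Ψ_β(z, λ) = (c, e)`. [folklore] -/
theorem lagMap_append_eq_append {z c : Fin k → ℝ} {lam : Fin q → ℝ} {e : Fin q → ℝ}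
    (hcrit : ∀ j, z j - c j = ∑ i, lam i * grad (g i) β z j)
    (hlev : ∀ i, (g i).realize (Sum.elim β z) = e i) :
    lagMap g β (Fin.append z lam) = Fin.append c e := by
  rw [lagMap_append_eq]
  congr 1
  · funext j
    have := hcrit j
    linarith
  · funext i
    exact hlev i

end Khovanskii

end Literature.ModelTheory.ExponentialFields
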